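import Summits.NavierStokesRegularity.NavierStokesRegularity.Theorems.AdaptedFrequencyConverges.Negative.AdaptedKernel
import Summits.NavierStokesRegularity.NavierStokesRegularity.Theses.AdaptedFrequency

/-!
# `AdaptedFrequencyConverges` is false without its far-field hypotheses

Negative-side support for crux `AdaptedFrequencyConverges` (stmt-NavierStokesRegularity-10493, route
`AdaptedFrequency`), cdisprove seat, cycle 1 (2026-08-16). Part of the kernel-checked proof that the crux is FALSE once
its far-field hypotheses (Leray–Hopf class, rapid decay, sup-norm Type-I) are dropped — `AdaptedFrequencyConvergesWithoutDecay`
in `…Negative.FalseWithoutDecay` — by an EXACT linear Navier–Stokes flow with an EXACT anisotropic Gaussian adapted kernel whose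
adapted frequency `Λ(t) = 2 cos log(1−t)` does not converge.

This file: adapted enstrophy `H = ω(t)²` and frequency `Λ = 2cos log(1−t)` of the witness (`frequency_eq`), non-convergence
(`not_tendsto_frequency`), the parabolic-local Type-I bound (`local_typeI_vel`), backward singularity of `(1,0)`
(`singular_vel`), the weakened statement (INLINE; named `AdaptedFrequencyConvergesWithoutDecay` in the crux workfile Disproof.lean: the crux
with Leray–Hopf, `HasRapidSpatialDecay` dropped and `IsTypeIBlowup` weakened to the parabolic-local bound; the crux's hypotheses
are stronger: `not_withoutDecay_of_not_adaptedFrequencyConverges`), and its refutation `adaptedFrequencyConverges_false_without_decay`.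

CONSEQUENCE (load-bearing analysis, D-0016 cdisprove (a)): every proof of the crux must use finite energy / spatial decay /
the sup over all `x` in the Type-I bound in a way that fails for linear flows; the card's `L²(G dx)` log-convexity mechanism
alone (kernel calculus + symmetric stretching + Agmon–Nirenberg defect) cannot close it, since here the transport of `ω`
vanishes identically (`∇ω = 0`), stretching is symmetric, the flow IS Navier–Stokes, and the strain-unsteadiness defect is
bounded but non-integrable and realised.
-/

noncomputable section

namespace Summit.NavierStokesRegularity.NavierStokesRegularity.Theorems.AdaptedFrequencyConverges.Negative

open scoped Matrix InnerProductSpace RealInnerProductSpace Laplacian Topology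
open Literature.Analysis.FluidPDE Set Filter MeasureTheory Real intervalIntegral

/-! ## Part D: adapted enstrophy and frequency of the linear flow; the refutation -/

/-- the adapted enstrophy is `ω(t)²` [folklore] -/
theorem integral_curl_vel_sq_mul_G {ν : ℝ} (hν : 0 < ν) {t : ℝ} (ht : t < 1) :
    ∫ x, ‖curl (vel t) x‖ ^ 2 * G ν t x = amp t ^ 2 := by
  rw [show vel t = linVel (str t) (amp t) from rfl]
  simp_rw [norm_curl_linVel_sq]
  rw [MeasureTheory.integral_const_mul, integral_G hν ht, mul_one]

/-- the adapted frequency is `2 cos (log (1 - t))` on `[0, 1)` [folklore] -/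
theorem frequency_eq {ν : ℝ} (hν : 0 < ν) {H Λ : ℝ → ℝ}
    (hH : H = fun t => ∫ x, ‖curl (vel t) x‖ ^ 2 * G ν t x)
    (hΛ : Λ = fun t => (1 - t) * deriv H t / H t) {t : ℝ} (ht : t < 1) :
    Λ t = 2 * Real.cos (Real.log (1 - t)) := by
  have hHeq : H =ᶠ[𝓝 t] fun s => amp s ^ 2 := by
    filter_upwards [Iio_mem_nhds ht] with s hs
    rw [hH]; exact integral_curl_vel_sq_mul_G hν hs
  have hd : deriv H t = 2 * amp t * (amp t * str t) := by
    rw [hHeq.deriv_eq]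
    have h2 : HasDerivAt (fun s => amp s ^ 2) (((2 : ℕ) : ℝ) * amp t ^ (2 - 1) * (amp t * str t)) t :=
      (hasDerivAt_amp ht).pow 2
    rw [h2.deriv]; norm_num
  have hHt : H t = amp t ^ 2 := hHeq.eq_of_nhds
  rw [hΛ]
  simp only [hd, hHt, str]
  have ha : amp t ≠ 0 := (amp_pos t).ne'
  have h1 : (1 - t) ≠ 0 := (sub_pos.2 ht).ne'
  field_simp

/-- **the adapted frequency of the linear flow has no limit at the singular time** [folklore] -/
theorem not_tendsto_frequency {ν : ℝ} (hν : 0 < ν) {H Λ : ℝ → ℝ}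
    (hH : H = fun t => ∫ x, ‖curl (vel t) x‖ ^ 2 * G ν t x)
    (hΛ : Λ = fun t => (1 - t) * deriv H t / H t) :
    ¬ ∃ Λ₀ : ℝ, Tendsto Λ (𝓝[<] 1) (𝓝 Λ₀) := by
  rintro ⟨Λ₀, hlim⟩
  -- two sequences tending to `1⁻` along which `Λ` is `2` and `-2`
  have hseq : ∀ c : ℝ, Tendsto (fun n : ℕ => 1 - Real.exp (-(n * (2 * π) + c))) atTop (𝓝[<] (1:ℝ)) := by
    intro c
    refine tendsto_nhdsWithin_iff.2 ⟨?_, Eventually.of_forall fun n => ?_⟩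
    · have h1 : Tendsto (fun n : ℕ => (n : ℝ) * (2 * π) + c) atTop atTop :=
        tendsto_atTop_add_const_right _ _ (tendsto_natCast_atTop_atTop.atTop_mul_const (by positivity))
      have h2 := Real.tendsto_exp_neg_atTop_nhds_zero.comp h1
      have h3 := h2.const_sub (1:ℝ)
      simpa using h3
    · exact sub_lt_self _ (Real.exp_pos _)
  have hval : ∀ (c : ℝ) (n : ℕ), Λ (1 - Real.exp (-(n * (2 * π) + c))) = 2 * Real.cos (n * (2 * π) + c) := by
    intro c n
    rw [frequency_eq hν hH hΛ (sub_lt_self _ (Real.exp_pos _)), sub_sub_cancel, Real.log_exp, Real.cos_neg]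
  have hlim0 := hlim.comp (hseq 0)
  have hlimπ := hlim.comp (hseq π)
  have e0 : (Λ ∘ fun n : ℕ => 1 - Real.exp (-(n * (2 * π) + 0))) = fun _ => 2 := by
    funext n; rw [Function.comp_apply, hval, add_zero, Real.cos_nat_mul_two_pi]; norm_num
  have eπ : (Λ ∘ fun n : ℕ => 1 - Real.exp (-(n * (2 * π) + π))) = fun _ => -2 := by
    funext n; rw [Function.comp_apply, hval, Real.cos_nat_mul_two_pi_add_pi]; norm_num
  rw [e0] at hlim0
  rw [eπ] at hlimπ
  have h2 : Λ₀ = 2 := tendsto_nhds_unique hlim0 tendsto_const_nhds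
  have hm2 : Λ₀ = -2 := tendsto_nhds_unique hlimπ tendsto_const_nhds
  linarith

/-- **parabolic-local Type-I bound** at the singular point `(1, 0)` [folklore] -/
theorem local_typeI_vel : ∃ C : ℝ, ∀ᶠ t in 𝓝[<] (1:ℝ), ∀ x : E3, ‖x - 0‖ ^ 2 ≤ 1 - t →
    ‖vel t x‖ ≤ C / Real.sqrt (1 - t) := by
  refine ⟨‖D0‖ + Real.exp 1 / 2 * ‖J‖, ?_⟩
  filter_upwards [Ico_mem_nhdsLT zero_lt_one] with t ht x hx
  rw [sub_zero] at hx
  have hτ : 0 < 1 - t := sub_pos.2 ht.2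
  have hτ1 : 1 - t ≤ 1 := by linarith [ht.1]
  have hsq : 0 < Real.sqrt (1 - t) := Real.sqrt_pos.2 hτ
  have hxle : ‖x‖ ≤ Real.sqrt (1 - t) := by
    rw [← Real.sqrt_sq (norm_nonneg x)]; exact Real.sqrt_le_sqrt hx
  have hstr : |str t| ≤ 1 / (1 - t) := by
    rw [str, abs_div, abs_of_pos hτ]
    exact div_le_div_of_nonneg_right (Real.abs_cos_le_one _) hτ.le
  have hamp : |amp t / 2| ≤ Real.exp 1 / 2 := by
    rw [abs_of_pos (by have := amp_pos t; positivity)]; linarith [amp_le t]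
  -- ‖u‖ ≤ |d| ‖D0‖ ‖x‖ + |ω/2| ‖J‖ ‖x‖
  have h1 : ‖vel t x‖ ≤ |str t| * (‖D0‖ * ‖x‖) + |amp t / 2| * (‖J‖ * ‖x‖) := by
    unfold vel linVel
    refine (norm_add_le _ _).trans (add_le_add ?_ ?_)
    · rw [norm_smul, Real.norm_eq_abs]
      exact mul_le_mul_of_nonneg_left (D0.le_opNorm x) (abs_nonneg _)
    · rw [norm_smul, Real.norm_eq_abs]
      exact mul_le_mul_of_nonneg_left (J.le_opNorm x) (abs_nonneg _)
  have hsqrt_le : Real.sqrt (1 - t) ≤ 1 / Real.sqrt (1 - t) := by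
    rw [le_div_iff₀ hsq, Real.mul_self_sqrt hτ.le]; exact hτ1
  have hinv : 1 / (1 - t) * Real.sqrt (1 - t) = 1 / Real.sqrt (1 - t) := by
    field_simp
    rw [Real.sq_sqrt hτ.le]
  calc ‖vel t x‖ ≤ |str t| * (‖D0‖ * ‖x‖) + |amp t / 2| * (‖J‖ * ‖x‖) := h1
    _ ≤ (1 / (1 - t)) * (‖D0‖ * Real.sqrt (1 - t)) + (Real.exp 1 / 2) * (‖J‖ * Real.sqrt (1 - t)) := by
        gcongr
    _ = ‖D0‖ * (1 / (1 - t) * Real.sqrt (1 - t)) + Real.exp 1 / 2 * ‖J‖ * Real.sqrt (1 - t) := by ring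
    _ ≤ ‖D0‖ * (1 / Real.sqrt (1 - t)) + Real.exp 1 / 2 * ‖J‖ * (1 / Real.sqrt (1 - t)) := by
        rw [hinv]; gcongr
    _ = (‖D0‖ + Real.exp 1 / 2 * ‖J‖) / Real.sqrt (1 - t) := by ring

/-! ## Part D2: `(1, 0)` is a backward-singular point of the linear flow -/

/-- along `tₙ = 1 − e^{−2πn}` the strain rate is `e^{2πn}`: the field is unbounded near `(1, 0)`
on the axis point `(r/2, 0, 0)` [folklore] -/
theorem vel_axis (t r : ℝ) : vel t (EuclideanSpace.single 0 r) = EuclideanSpace.single 0 (str t * r) := by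
  ext i
  fin_cases i <;> simp [vel]

/-- `‖c e₀‖ = |c|`. [folklore] -/
theorem norm_single_zero (c : ℝ) : ‖(EuclideanSpace.single (0 : Fin 3) c : E3)‖ = |c| := by
  rw [EuclideanSpace.norm_eq]
  simp [Real.sqrt_sq_eq_abs]

/-- Along `tₙ = 1 − e^{−2πn}` the strain rate is `e^{2πn}`. [folklore] -/
theorem str_special (n : ℕ) : str (1 - Real.exp (-(n * (2 * π)))) = Real.exp (n * (2 * π)) := by
  rw [str, sub_sub_cancel, Real.log_exp, Real.cos_neg, Real.cos_nat_mul_two_pi, Real.exp_neg]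
  field_simp

/-- **backward singularity**: `u` is essentially unbounded on every parabolic cylinder at `(1, 0)` [folklore] -/
theorem singular_vel (r : ℝ) (hr : 0 < r) :
    eLpNorm (Function.uncurry vel) ⊤ (volume.restrict (parabolicCylinder r ((1:ℝ), (0 : E3)))) = ⊤ := by
  by_contra hne
  set S := eLpNorm (Function.uncurry vel) ⊤ (volume.restrict (parabolicCylinder r ((1:ℝ), (0:E3))))
    with hS
  have hSlt : S < ⊤ := lt_top_iff_ne_top.2 hne
  -- a.e. bound on the cylinder
  have hae : ∀ᵐ p ∂(volume.restrict (parabolicCylinder r ((1:ℝ), (0:E3)))),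
      ‖Function.uncurry vel p‖ₑ ≤ S := by
    rw [hS, eLpNorm_exponent_top]; exact ae_le_eLpNormEssSup
  -- choose n with e^{-2πn} < r² and (r/2) e^{2πn} > S.toReal + 1
  obtain ⟨n, hn⟩ : ∃ n : ℕ, max (Real.log (r ^ 2)⁻¹) (Real.log ((S.toReal + 1) / (r / 2))) < n * (2 * π) := by
    obtain ⟨n, hn⟩ := exists_nat_gt (max (Real.log (r ^ 2)⁻¹) (Real.log ((S.toReal + 1) / (r / 2))) / (2 * π))
    exact ⟨n, (div_lt_iff₀ (by positivity)).1 hn⟩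
  have hn1 : Real.exp (-(n * (2 * π))) < r ^ 2 := by
    rw [Real.exp_neg, inv_lt_comm₀ (Real.exp_pos _) (by positivity), ← Real.log_lt_iff_lt_exp (by positivity)]
    exact (le_max_left _ _).trans_lt hn
  have hn2 : S.toReal + 1 < (r / 2) * Real.exp (n * (2 * π)) := by
    rw [← div_lt_iff₀' (by positivity), ← Real.log_lt_iff_lt_exp (by positivity)]
    exact (le_max_right _ _).trans_lt hn
  set t₀ : ℝ := 1 - Real.exp (-(n * (2 * π))) with ht₀
  set x₀ : E3 := EuclideanSpace.single 0 (r / 2) with hx₀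
  have ht₀1 : t₀ < 1 := sub_lt_self _ (Real.exp_pos _)
  have hval : ‖vel t₀ x₀‖ = (r / 2) * Real.exp (n * (2 * π)) := by
    rw [hx₀, vel_axis, ht₀, str_special, norm_single_zero, abs_of_pos (by positivity)]
    ring
  -- the open set where `‖u‖ > S.toReal + 1`, intersected with the cylinder, has positive measure
  set U : Set (ℝ × E3) := {p | S.toReal + 1 < ‖Function.uncurry vel p‖} ∩ (Iio 1 ×ˢ univ) with hU
  have hcont : ContinuousOn (fun p : ℝ × E3 => ‖Function.uncurry vel p‖) (Iio 1 ×ˢ univ) :=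
    fun p hp => ((contDiffAt_uncurry_vel (n := 0) (mem_prod.1 hp).1 p.2).continuousAt.norm).continuousWithinAt
  have hUo : IsOpen U := by
    rw [hU, inter_comm]
    exact hcont.isOpen_inter_preimage (isOpen_Iio.prod isOpen_univ) isOpen_Ioi
  have hmem : ((t₀, x₀) : ℝ × E3) ∈ U ∩ parabolicCylinder r ((1:ℝ), (0:E3)) := by
    refine ⟨⟨?_, ht₀1, mem_univ _⟩, ?_⟩
    · show S.toReal + 1 < ‖vel t₀ x₀‖
      rw [hval]; exact hn2
    · rw [mem_parabolicCylinder]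
      refine ⟨⟨by rw [ht₀]; linarith, ht₀1⟩, ?_⟩
      rw [hx₀, dist_zero_right, norm_single_zero, abs_of_pos (by positivity)]
      linarith
  have hpos : 0 < volume (U ∩ parabolicCylinder r ((1:ℝ), (0:E3))) :=
    (hUo.inter (isOpen_parabolicCylinder r _)).measure_pos volume ⟨_, hmem⟩
  -- but the a.e. bound says this set is null
  have hnull : volume.restrict (parabolicCylinder r ((1:ℝ), (0:E3))) U = 0 := by
    refine measure_eq_zero_iff_ae_notMem.2 ?_
    filter_upwards [hae] with p hp hpU
    have h1 : ‖Function.uncurry vel p‖ₑ ≤ S := hp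
    have h2 : S.toReal + 1 < ‖Function.uncurry vel p‖ := hpU.1
    have h3 : (‖Function.uncurry vel p‖ₑ).toReal ≤ S.toReal := ENNReal.toReal_mono hne h1
    rw [toReal_enorm] at h3
    linarith
  rw [Measure.restrict_apply hUo.measurableSet] at hnull
  exact hpos.ne' hnull


/-! ## Part E: the load-bearing statement and its refutation -/

open Summit.NavierStokesRegularity.NavierStokesRegularity.Theses.AdaptedFrequency

/-- The crux's hypotheses are STRONGER than those of the weakened statement (the local Type-I bound
follows from `IsTypeIBlowup`; Leray–Hopf and decay are simply not used), stated contrapositively so that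
the conclusion is negative: a refutation of the crux would refute the weakened statement, and — the
point — `adaptedFrequencyConverges_false_without_decay` below is a genuine LOAD-BEARING lemma: every
proof of the crux must use Leray–Hopf / decay / the sup-norm in the Type-I bound. [folklore] -/
theorem not_withoutDecay_of_not_adaptedFrequencyConverges (h : ¬ AdaptedFrequencyConverges) :
    ¬ (∀ (ν T : ℝ), 0 < ν → 0 < T → ∀ (u : ℝ → EuclideanSpace ℝ (Fin 3) → EuclideanSpace ℝ (Fin 3)) (p : ℝ → EuclideanSpace ℝ (Fin 3) → ℝ), Literature.Analysis.FluidPDE.IsClassicalNSSolutionOn (Set.Ico 0 T) ν 0 u p → ∀ (x₀ : EuclideanSpace ℝ (Fin 3)) (t₀ : ℝ) (G : ℝ → EuclideanSpace ℝ (Fin 3) → ℝ), t₀ ∈ Set.Ico 0 T → (∃ C : ℝ, ∀ᶠ t in 𝓝[<] T, ∀ x, ‖x - x₀‖ ^ 2 ≤ T - t → ‖u t x‖ ≤ C / Real.sqrt (T - t)) → (∀ r : ℝ, 0 < r → MeasureTheory.eLpNorm (Function.uncurry u) ⊤ (MeasureTheory.Measure.restrict MeasureTheory.volume (Literature.Analysis.FluidPDE.parabolicCylinder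 r (T, x₀))) = ⊤) → ContDiffOn ℝ 2 (Function.uncurry G) (Set.Ico t₀ T ×ˢ Set.univ) ∧ (∀ t ∈ Set.Ico t₀ T, ∀ x, 0 < G t x) ∧ (∀ t ∈ Set.Ico t₀ T, ∀ x, Literature.Analysis.FluidPDE.timeDerivWithin (Set.Ico t₀ T) G t x + fderiv ℝ (G t) x (u t x) + ν * Laplacian.laplacian (G t) x = 0) ∧ (∀ t ∈ Set.Ico t₀ T, ∫ x, G t x = 1) ∧ (∀ φ : EuclideanSpace ℝ (Fin 3) → ℝ, Continuous φ → (∃ M : ℝ, ∀ x, |φ x| ≤ M) → Filter.Tendsto (fun t => ∫ x, φ x * G t x) (nhdsWithin T (Set.Iio T)) (nhds (φ x₀))) → (∃ c₁ c₂ C₁ C₂ : ℝ, 0 < c₁ ∧ 0 < c₂ ∧ 0 < C₁ ∧ 0 < C₂ ∧ ∀ t ∈ Set.Ico t₀ T, ∀ x, c₁ * (T - t) ^ (-(3:ℝ) / 2) * Real.exp (-(‖x - x₀‖ ^ 2) / (c₂ * (T - t))) ≤ G t x ∧ G t x ≤ C₁ * (T - t) ^ (-(3:ℝ) / 2) * Real.exp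 (-(‖x - x₀‖ ^ 2) / (C₂ * (T - t)))) → ∀ H Λ : ℝ → ℝ, H = (fun t => ∫ x, ‖Literature.Analysis.FluidPDE.curl (u t) x‖ ^ 2 * G t x) → Λ = (fun t => (T - t) * deriv H t / H t) → ∃ Λ₀ : ℝ, Filter.Tendsto Λ (nhdsWithin T (Set.Iio T)) (nhds Λ₀)) := by
  intro hW
  apply h
  intro ν T hν hT u p hcl _hLH _hdec hTI x₀ t₀ G ht₀ hsing hK hcomp H Λ hH hΛ
  refine hW ν T hν hT u p hcl x₀ t₀ G ht₀ ?_ hsing hK hcomp H Λ hH hΛ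
  obtain ⟨C, hC⟩ := hTI
  exact ⟨C, hC.mono fun t ht x _ => ht x⟩

/-- the five adapted-kernel clauses for the kernel `G ν` of the linear flow on `[0, 1)` [folklore] -/
theorem kernel_clauses {ν : ℝ} (hν : 0 < ν) :
    ContDiffOn ℝ 2 (Function.uncurry (G ν)) (Set.Ico 0 1 ×ˢ Set.univ) ∧
    (∀ t ∈ Set.Ico (0:ℝ) 1, ∀ x, 0 < G ν t x) ∧
    (∀ t ∈ Set.Ico (0:ℝ) 1, ∀ x, timeDerivWithin (Set.Ico 0 1) (G ν) t x +
      fderiv ℝ (G ν t) x (vel t x) + ν * Laplacian.laplacian (G ν t) x = 0) ∧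
    (∀ t ∈ Set.Ico (0:ℝ) 1, ∫ x, G ν t x = 1) ∧
    (∀ φ : E3 → ℝ, Continuous φ → (∃ M : ℝ, ∀ x, |φ x| ≤ M) →
      Tendsto (fun t => ∫ x, φ x * G ν t x) (𝓝[<] 1) (𝓝 (φ 0))) :=
  ⟨contDiffOn_uncurry_G_Ico ν hν, fun _ ht x => G_pos hν ht.2 x, fun _ ht x => adjoint_eq_G hν ht x,
    fun _ ht => integral_G hν ht.2, fun _ hφ hM => tendsto_integral_mul_G hν hφ hM⟩

/-- **`AdaptedFrequencyConverges` is false without its far-field hypotheses.**  The negated statement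
(written INLINE; it is `AdaptedFrequencyConvergesWithoutDecay` of the crux workfile
`Cruxes/AdaptedFrequencyConverges/Disproof.lean`) is the crux `AdaptedFrequencyConverges` with the
Leray–Hopf class and `HasRapidSpatialDecay (u 0)` DROPPED and `IsTypeIBlowup u T` WEAKENED to the
parabolic-local Type-I bound `‖x − x₀‖² ≤ T − t → ‖u t x‖ ≤ C/√(T − t)` (eventually as `t ↑ T`);
everything local kept verbatim (exact unforced classical NS on `[0,T)`, backward singularity at
`(T,x₀)`, the five adapted-kernel clauses, two-sided comparability, the conclusion).
**Original docstring:** `AdaptedFrequencyConverges` is false without its far-field hypotheses (any proof must use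
finite energy / decay / the sup-norm Type-I bound): witnessed at `ν = T = 1`, `x₀ = 0`, `t₀ = 0`
by the exact linear Navier–Stokes flow `vel`/`pres`, its exact anisotropic Gaussian adapted kernel
`G 1`, adapted enstrophy `ω(t)²` and adapted frequency `2 cos log(1−t)`, which does not converge. [folklore] -/
theorem adaptedFrequencyConverges_false_without_decay :
    ¬ (∀ (ν T : ℝ), 0 < ν → 0 < T → ∀ (u : ℝ → EuclideanSpace ℝ (Fin 3) → EuclideanSpace ℝ (Fin 3)) (p : ℝ → EuclideanSpace ℝ (Fin 3) → ℝ), Literature.Analysis.FluidPDE.IsClassicalNSSolutionOn (Set.Ico 0 T) ν 0 u p → ∀ (x₀ : EuclideanSpace ℝ (Fin 3)) (t₀ : ℝ) (G : ℝ → EuclideanSpace ℝ (Fin 3) → ℝ), t₀ ∈ Set.Ico 0 T → (∃ C : ℝ, ∀ᶠ t in 𝓝[<] T, ∀ x, ‖x - x₀‖ ^ 2 ≤ T - t → ‖u t x‖ ≤ C / Real.sqrt (T - t)) → (∀ r : ℝ, 0 < r → MeasureTheory.eLpNorm (Function.uncurry u) ⊤ (MeasureTheory.Measure.restrict MeasureTheory.volume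 (Literature.Analysis.FluidPDE.parabolicCylinder r (T, x₀))) = ⊤) → ContDiffOn ℝ 2 (Function.uncurry G) (Set.Ico t₀ T ×ˢ Set.univ) ∧ (∀ t ∈ Set.Ico t₀ T, ∀ x, 0 < G t x) ∧ (∀ t ∈ Set.Ico t₀ T, ∀ x, Literature.Analysis.FluidPDE.timeDerivWithin (Set.Ico t₀ T) G t x + fderiv ℝ (G t) x (u t x) + ν * Laplacian.laplacian (G t) x = 0) ∧ (∀ t ∈ Set.Ico t₀ T, ∫ x, G t x = 1) ∧ (∀ φ : EuclideanSpace ℝ (Fin 3) → ℝ, Continuous φ → (∃ M : ℝ, ∀ x, |φ x| ≤ M) → Filter.Tendsto (fun t => ∫ x, φ x * G t x) (nhdsWithin T (Set.Iio T)) (nhds (φ x₀))) → (∃ c₁ c₂ C₁ C₂ : ℝ, 0 < c₁ ∧ 0 < c₂ ∧ 0 < C₁ ∧ 0 < C₂ ∧ ∀ t ∈ Set.Ico t₀ T, ∀ x, c₁ * (T - t) ^ (-(3:ℝ) / 2) * Real.exp (-(‖x - x₀‖ ^ 2) / (c₂ * (T - t))) ≤ G t x ∧ G t x ≤ C₁ *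 (T - t) ^ (-(3:ℝ) / 2) * Real.exp (-(‖x - x₀‖ ^ 2) / (C₂ * (T - t)))) → ∀ H Λ : ℝ → ℝ, H = (fun t => ∫ x, ‖Literature.Analysis.FluidPDE.curl (u t) x‖ ^ 2 * G t x) → Λ = (fun t => (T - t) * deriv H t / H t) → ∃ Λ₀ : ℝ, Filter.Tendsto Λ (nhdsWithin T (Set.Iio T)) (nhds Λ₀)) := by
  intro h
  have h1 : (0:ℝ) < 1 := one_pos
  obtain ⟨Λ₀, hlim⟩ := h 1 1 h1 h1 vel pres (isClassicalNSSolutionOn_vel 1) 0 0 (G 1)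
    ⟨le_rfl, h1⟩ local_typeI_vel singular_vel (kernel_clauses h1) (G_comparable h1) _ _ rfl rfl
  exact not_tendsto_frequency h1 rfl rfl ⟨Λ₀, hlim⟩


end Summit.NavierStokesRegularity.NavierStokesRegularity.Theorems.AdaptedFrequencyConverges.Negative

end
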